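import Mathlib
import HarnessLib
import Summits.Ventures.LatticeQCDFlow.Exactness.NCMCGeneralSpaceRatioStudentizedCLT

/-!
# The plug-in error bar of a reweighted observable is asymptotically honest (Crooks pairs, general state space)

HONEST FRAMING: exact (Metropolis-corrected) sampling algorithms for lattice gauge theory;
figures of merit are autocorrelation/cost numbers at stated couplings and volumes; no
continuum-physics claim.

Venture `LatticeQCDFlow` (cell pub-lqcd), topic `Exactness`; FANOUT row 13 (`eng-snf`, GEN-14).
NEW WORK of the cell (elementary), not a published result; nothing is cited as a fact.  Continuation
of `NCMCGeneralSpaceReweightedCLT.lean` (GEN-12: for every Crooks pair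
`√n (Σ e^{−W_i} f(end_i)/Σ e^{−W_i} − m) →d N(0, E_F[e^{−2(W−ΔF)}(f(end) − m)²])`) and of
`NCMCGeneralSpaceRatioStudentizedCLT.lean` (GEN-14: the studentized CLT for a self-normalised
ratio along an i.i.d. run).  GEN-12 says what the asymptotic variance of a reweighted observable IS;
this file says that the engine's PLUG-IN error bar estimates it consistently, so the reported
interval `f̂ ± z·err` has the advertised asymptotic coverage — the reweighting counterpart of
GEN-13's `NCMCGeneralSpaceStudentizedCLT.lean` for `dF ± z·err`.

## Setting and content

A Crooks pair `(κF, κR, s, e, W)` from `ν₀` to `ν₁` (GEN-9 `NCMCGeneralSpace.lean`) with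
`e^{−ΔF} = Z₁/Z₀`, `P_F = fwdPathLaw ν₀ κF`, weights `w_i = e^{−W_i}`, a measurable end-point
observable `f` with `w f(end), w ∈ L²(P_F)`, target mean `m = (ν₁ Ω)⁻¹ ∫ f dν₁`, independent forward
evolutions `Measure.infinitePi (fun _ => P_F)`, `f̂_n = Σ_{i<n} w_i f(end_i)/Σ_{i<n} w_i` and the
engine's PLUG-IN ERROR BAR `err_n = √(Σ_{i<n} w_i² (f(end_i) − f̂_n)²) / Σ_{i<n} w_i`.

* `CrooksPair.ratio_integral_reweight_eq` — the ratio of the two reweighting means is `m`;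
  `CrooksPair.variance_reweight_residual_eq` —
  `Var_F[w f(end) − m w]/(E_F w)² = E_F[e^{−2(W−ΔF)}(f(end) − m)²]` (GEN-12's asymptotic variance).
* **`CrooksPair.tendstoInDistribution_reweighted_studentized`** — `(f̂_n − m)/err_n →d N(0, 1)`
  whenever the asymptotic variance `E_F[e^{−2(W−ΔF)}(f(end) − m)²]` is positive (the observable is
  not `P_F`-a.s. constant at the end point).
* **`CrooksPair.tendsto_measure_abs_reweighted_sub_le`** — THE REPORTED INTERVAL IS ASYMPTOTICALLY
  HONEST: for `z ≥ 0` the probability that `|(f̂_n − m)/err_n| ≤ z` tends to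
  `gaussianReal 0 1 [−z, z] = P(|N(0,1)| ≤ z)`.
  Reading for the engine (`estimators.reweight`): for independent evolutions the delta-method
  ("sandwich") error bar `√(Σ w²(f − f̂)²)/Σ w` is the asymptotically exact one for a reweighted
  observable; `√(Var_f/(N·ESS))`-type shortcuts are not what this theorem licenses.

Scope / NOT CLAIMED: independent evolutions only (correlated chain starts and the block jackknife
are not covered); asymptotic coverage only — no finite-`N` guarantee and no rate; the degenerate
case of zero asymptotic variance is excluded; no value for any concrete protocol or observable.
-/

namespace Summit.Ventures.LatticeQCDFlow.Exactness.GeneralNCMC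

open MeasureTheory ProbabilityTheory Set Filter Finset
open scoped ENNReal NNReal Topology

variable {E : Type*} [MeasurableSpace E]

/-! ## For a Crooks pair: the reported error bar of a reweighted observable is asymptotically honest -/

namespace CrooksPair

variable {Ω : Type*} [MeasurableSpace Ω]
variable {ν₀ ν₁ : Measure Ω} {κF κR : Kernel Ω E} {s e : E → Ω} {W : E → ℝ}
variable {Ω' : Type*} [MeasurableSpace Ω'] {P' : Measure Ω'} [IsProbabilityMeasure P']

/-- The ratio of the two reweighting means is the TARGET mean:
`E_F[e^{−W} f(end)] / E_F[e^{−W}] = (ν₁ Ω)⁻¹ ∫ f dν₁`. -/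
theorem ratio_integral_reweight_eq [IsFiniteMeasure ν₀] [IsFiniteMeasure ν₁] [IsMarkovKernel κR]
    (h0 : ν₀ univ ≠ 0) (h1 : ν₁ univ ≠ 0) (h : CrooksPair ν₀ ν₁ κF κR s e W) {f : Ω → ℝ}
    (hfm : Measurable f) :
    (∫ ε, Real.exp (-W ε) * f (e ε) ∂(fwdPathLaw ν₀ κF)) / (∫ ε, Real.exp (-W ε) ∂(fwdPathLaw ν₀ κF)) =
      ((ν₁ univ)⁻¹).toReal * ∫ y, f y ∂ν₁ := by
  have hZ1 : (ν₁ univ).toReal ≠ 0 := (ENNReal.toReal_pos h1 (measure_ne_top ν₁ univ)).ne'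
  have hZ0 : (ν₀ univ).toReal ≠ 0 := (ENNReal.toReal_pos h0 (measure_ne_top ν₀ univ)).ne'
  rw [h.integral_exp_neg_work_mul_comp_end hfm.aestronglyMeasurable, h.integral_exp_neg_work,
    ENNReal.toReal_mul, ENNReal.toReal_inv, ENNReal.toReal_inv]
  field_simp

/-- The asymptotic variance of GEN-12's ratio CLT, written with the dissipated work:
`Var_F[e^{−W} f(end) − m e^{−W}] / (E_F e^{−W})² = E_F[e^{−2(W−ΔF)} (f(end) − m)²]`. -/
theorem variance_reweight_residual_eq [IsFiniteMeasure ν₀] [IsFiniteMeasure ν₁]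
    [IsMarkovKernel κF] [IsMarkovKernel κR] (h0 : ν₀ univ ≠ 0) (h1 : ν₁ univ ≠ 0)
    (h : CrooksPair ν₀ ν₁ κF κR s e W) {f : Ω → ℝ} (hfm : Measurable f)
    (hA2 : MemLp (fun ε => Real.exp (-W ε) * f (e ε)) 2 (fwdPathLaw ν₀ κF))
    (hB2 : MemLp (fun ε => Real.exp (-W ε)) 2 (fwdPathLaw ν₀ κF)) {ΔF : ℝ}
    (hΔF : Real.exp (-ΔF) = ((ν₀ univ)⁻¹ * ν₁ univ).toReal) :
    haveI := isProbabilityMeasure_fwdPathLaw ν₀ h0 κF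
    Var[fun ε => Real.exp (-W ε) * f (e ε) - ((ν₁ univ)⁻¹).toReal * (∫ y, f y ∂ν₁) * Real.exp (-W ε);
        fwdPathLaw ν₀ κF] / (∫ ε, Real.exp (-W ε) ∂(fwdPathLaw ν₀ κF)) ^ 2 =
      ∫ ε, Real.exp (-(2 * (W ε - ΔF))) *
        (f (e ε) - ((ν₁ univ)⁻¹).toReal * ∫ y, f y ∂ν₁) ^ 2 ∂(fwdPathLaw ν₀ κF) := by
  haveI := isProbabilityMeasure_fwdPathLaw ν₀ h0 κF
  set m := ((ν₁ univ)⁻¹).toReal * ∫ y, f y ∂ν₁ with hmdef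
  have hβ : ∫ ε, Real.exp (-W ε) ∂(fwdPathLaw ν₀ κF) = Real.exp (-ΔF) := by
    rw [h.integral_exp_neg_work, hΔF]
  have hr : (∫ ε, Real.exp (-W ε) * f (e ε) ∂(fwdPathLaw ν₀ κF)) /
      (∫ ε, Real.exp (-W ε) ∂(fwdPathLaw ν₀ κF)) = m := by
    rw [hmdef]
    exact h.ratio_integral_reweight_eq h0 h1 hfm
  have hd2 : MemLp (fun ε => Real.exp (-W ε) * f (e ε) - m * Real.exp (-W ε)) 2 (fwdPathLaw ν₀ κF) :=
    hA2.sub (hB2.const_mul m)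
  have hdmean : ∫ ε, Real.exp (-W ε) * f (e ε) - m * Real.exp (-W ε) ∂(fwdPathLaw ν₀ κF) = 0 := by
    rw [integral_sub (hA2.integrable one_le_two) ((hB2.integrable one_le_two).const_mul m),
      integral_const_mul, ← hr, div_mul_cancel₀ _ (hβ ▸ Real.exp_pos _).ne', sub_self]
  rw [variance_eq_sub hd2, hdmean, hβ, zero_pow two_ne_zero, sub_zero, ← integral_div]
  refine integral_congr_ae (Eventually.of_forall fun ε => ?_)
  simp only [Pi.pow_apply]
  have hexp : Real.exp (-(2 * (W ε - ΔF))) = Real.exp (-W ε) ^ 2 / Real.exp (-ΔF) ^ 2 := by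
    rw [sq, sq, ← Real.exp_add, ← Real.exp_add, ← Real.exp_sub]
    congr 1
    ring
  rw [hexp]
  have hne : Real.exp (-ΔF) ^ 2 ≠ 0 := pow_ne_zero 2 (Real.exp_pos _).ne'
  field_simp

/-- **Studentized CLT for reweighted end-point observables of a Crooks pair.**  For every Crooks
pair on a general measurable state space with `e^{−ΔF} = Z₁/Z₀`, every measurable `f` with
`e^{−W} f(end), e^{−W} ∈ L²(P_F)` and POSITIVE asymptotic variance `E_F[e^{−2(W−ΔF)}(f(end) − m)²]`,
`m = (ν₁ Ω)⁻¹ ∫ f dν₁`, along an infinite run of independent forward evolutions: with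
`f̂_n = Σ_{i<n} w_i f(end_i)/Σ_{i<n} w_i`, `w_i = e^{−W_i}`, and the plug-in error bar
`err_n = √(Σ_{i<n} w_i² (f(end_i) − f̂_n)²) / Σ_{i<n} w_i`, `(f̂_n − m)/err_n →d N(0, 1)`. -/
theorem tendstoInDistribution_reweighted_studentized [IsFiniteMeasure ν₀] [IsFiniteMeasure ν₁]
    [IsMarkovKernel κF] [IsMarkovKernel κR] (h0 : ν₀ univ ≠ 0) (h1 : ν₁ univ ≠ 0)
    (h : CrooksPair ν₀ ν₁ κF κR s e W) {f : Ω → ℝ} (hfm : Measurable f)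
    (hA2 : MemLp (fun ε => Real.exp (-W ε) * f (e ε)) 2 (fwdPathLaw ν₀ κF))
    (hB2 : MemLp (fun ε => Real.exp (-W ε)) 2 (fwdPathLaw ν₀ κF)) {ΔF : ℝ}
    (hΔF : Real.exp (-ΔF) = ((ν₀ univ)⁻¹ * ν₁ univ).toReal)
    (hV : 0 < ∫ ε, Real.exp (-(2 * (W ε - ΔF))) *
      (f (e ε) - ((ν₁ univ)⁻¹).toReal * ∫ y, f y ∂ν₁) ^ 2 ∂(fwdPathLaw ν₀ κF))
    {Z : Ω' → ℝ} (hZ : HasLaw Z (gaussianReal 0 1) P') :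
    haveI := isProbabilityMeasure_fwdPathLaw ν₀ h0 κF
    TendstoInDistribution
      (fun (n : ℕ) (ω : ℕ → E) =>
        ((∑ i ∈ range n, Real.exp (-W (ω i)) * f (e (ω i))) / (∑ i ∈ range n, Real.exp (-W (ω i))) -
            ((ν₁ univ)⁻¹).toReal * ∫ y, f y ∂ν₁) /
          (√(∑ i ∈ range n, Real.exp (-W (ω i)) ^ 2 * (f (e (ω i)) -
              (∑ j ∈ range n, Real.exp (-W (ω j)) * f (e (ω j))) /
                (∑ j ∈ range n, Real.exp (-W (ω j)))) ^ 2) /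
            ∑ i ∈ range n, Real.exp (-W (ω i))))
      atTop Z (fun _ => Measure.infinitePi fun _ : ℕ => fwdPathLaw ν₀ κF) P' := by
  haveI := isProbabilityMeasure_fwdPathLaw ν₀ h0 κF
  set m := ((ν₁ univ)⁻¹).toReal * ∫ y, f y ∂ν₁ with hmdef
  have ham : Measurable fun ε => Real.exp (-W ε) * f (e ε) :=
    (Real.measurable_exp.comp h.measurable_W.neg).mul (hfm.comp h.measurable_e)
  have hbm : Measurable fun ε => Real.exp (-W ε) := Real.measurable_exp.comp h.measurable_W.neg
  have hr := h.ratio_integral_reweight_eq h0 h1 hfm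
  have hθ : 0 < ∫ ε, Real.exp (-W ε) ∂(fwdPathLaw ν₀ κF) := by
    rw [h.integral_exp_neg_work, hΔF.symm]
    exact Real.exp_pos _
  -- positivity of `Var_F[a − m b]` from the positivity of the asymptotic variance
  have hσ : 0 < Var[fun ε => Real.exp (-W ε) * f (e ε) -
      (∫ ε, Real.exp (-W ε) * f (e ε) ∂(fwdPathLaw ν₀ κF)) /
        (∫ ε, Real.exp (-W ε) ∂(fwdPathLaw ν₀ κF)) * Real.exp (-W ε); fwdPathLaw ν₀ κF] := by
    rw [hr]
    have hid := h.variance_reweight_residual_eq h0 h1 hfm hA2 hB2 hΔF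
    rw [← hmdef] at hid ⊢
    have hpos : 0 < Var[fun ε => Real.exp (-W ε) * f (e ε) - m * Real.exp (-W ε); fwdPathLaw ν₀ κF] /
        (∫ ε, Real.exp (-W ε) ∂(fwdPathLaw ν₀ κF)) ^ 2 := by
      rw [hid]
      exact hV
    exact (div_pos_iff_of_pos_right (pow_pos hθ 2)).1 hpos
  have main := tendstoInDistribution_studentized_ratio (fwdPathLaw ν₀ κF) ham hbm
    (fun ε => Real.exp_pos _) hA2 hB2 hσ hZ
  rw [hr] at main
  refine main.congr (fun n => Eventually.of_forall fun ω => ?_) (Eventually.of_forall fun _ => rfl)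
  beta_reduce
  rw [div_div_eq_mul_div]
  congr 2
  refine Finset.sum_congr rfl fun i _ => ?_
  ring

/-- **The reported interval `f̂ ± z·err` is asymptotically honest.**  Under the hypotheses of
`tendstoInDistribution_reweighted_studentized`, for every `z ≥ 0` the probability that
`|(f̂_n − m)/err_n| ≤ z` — i.e. that the target mean `m` lies in `[f̂_n − z err_n, f̂_n + z err_n]`
whenever `err_n > 0` — converges to `gaussianReal 0 1 [−z, z] = P(|N(0,1)| ≤ z)`. -/
theorem tendsto_measure_abs_reweighted_sub_le [IsFiniteMeasure ν₀] [IsFiniteMeasure ν₁]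
    [IsMarkovKernel κF] [IsMarkovKernel κR] (h0 : ν₀ univ ≠ 0) (h1 : ν₁ univ ≠ 0)
    (h : CrooksPair ν₀ ν₁ κF κR s e W) {f : Ω → ℝ} (hfm : Measurable f)
    (hA2 : MemLp (fun ε => Real.exp (-W ε) * f (e ε)) 2 (fwdPathLaw ν₀ κF))
    (hB2 : MemLp (fun ε => Real.exp (-W ε)) 2 (fwdPathLaw ν₀ κF)) {ΔF : ℝ}
    (hΔF : Real.exp (-ΔF) = ((ν₀ univ)⁻¹ * ν₁ univ).toReal)
    (hV : 0 < ∫ ε, Real.exp (-(2 * (W ε - ΔF))) *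
      (f (e ε) - ((ν₁ univ)⁻¹).toReal * ∫ y, f y ∂ν₁) ^ 2 ∂(fwdPathLaw ν₀ κF)) {z : ℝ} (hz : 0 ≤ z) :
    haveI := isProbabilityMeasure_fwdPathLaw ν₀ h0 κF
    Tendsto (fun n : ℕ => (Measure.infinitePi fun _ : ℕ => fwdPathLaw ν₀ κF)
        {ω | |((∑ i ∈ range n, Real.exp (-W (ω i)) * f (e (ω i))) / (∑ i ∈ range n, Real.exp (-W (ω i))) -
            ((ν₁ univ)⁻¹).toReal * ∫ y, f y ∂ν₁) /
          (√(∑ i ∈ range n, Real.exp (-W (ω i)) ^ 2 * (f (e (ω i)) -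
              (∑ j ∈ range n, Real.exp (-W (ω j)) * f (e (ω j))) /
                (∑ j ∈ range n, Real.exp (-W (ω j)))) ^ 2) /
            ∑ i ∈ range n, Real.exp (-W (ω i)))| ≤ z})
      atTop (𝓝 (gaussianReal 0 1 (Icc (-z) z))) := by
  haveI := isProbabilityMeasure_fwdPathLaw ν₀ h0 κF
  have hlim := h.tendstoInDistribution_reweighted_studentized h0 h1 hfm hA2 hB2 hΔF hV
    (P' := gaussianReal 0 1) (Z := id) HasLaw.id
  have hnull : ((gaussianReal 0 1).map id) (frontier (Icc (-z) z)) = 0 := by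
    rw [Measure.map_id, frontier_Icc (by linarith : -z ≤ z)]
    haveI := nullSingletonClass_gaussianReal (μ := 0) (v := 1) one_ne_zero
    exact (Set.toFinite {-z, z}).measure_zero _
  have key := ProbabilityMeasure.tendsto_measure_of_null_frontier_of_tendsto' hlim.tendsto
    (E := Icc (-z) z) (by simpa using hnull)
  simp only [ProbabilityMeasure.coe_mk, Measure.map_id] at key
  refine key.congr fun n => ?_
  rw [Measure.map_apply_of_aemeasurable (hlim.forall_aemeasurable n) measurableSet_Icc]
  congr 1
  ext ω
  simp only [Set.mem_preimage, Set.mem_Icc, mem_setOf_eq, abs_le]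

end CrooksPair

end Summit.Ventures.LatticeQCDFlow.Exactness.GeneralNCMC
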